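import Summits.QuantumFields.YangMills.Theorems.UnitScaleTiltFluctuationComparisonRegPrGlobalSlackCanonicalPolymers
import Summits.QuantumFields.Balaban3D.Proofs.NewbornJet
import Summits.QuantumFields.Balaban3D.Proofs.Bound46Series
import HarnessLib

/-!
# `UnitScaleTiltFluctuationComparisonRegPrGlobalSlackCanonicalPolymersSizes` — THE SIZE OF THE NEW TERMS OF THE CANONICAL POLYMERISATION ((44)/(34) at birth)
# (crux `FluctuationComparisonRegPrL`, stmt-QuantumFields-19935, STUB 3⁗ `stub_globalTwoRunSlackFam`; width-lever lane A, towards the producer's fifth row `TermSizeTrivT`)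

Seat ym-ust-19935-slack g0 (prover).  For the canonical term function `canonPT p` of a v3 family (`…GlobalSlackCanonicalPolymers`, p533541) the NEW term of a
retained domain `X` at step `k` of run `K`, `newTerm p K k X W = (Re jet26(Ψ_X)(B_X) − far_X) + (Re jet26(Λ_X)(B_X) − farΛ_X)`, is bounded by
`Cnew(𝔠)·(g_k p(g_k))²·e^{−κ𝓛(X)}` — print's (44)/(34) at the birth level with the coupling window `θ = g p(g)` — from the DISPLAYED rows of
`AlphaV3AC.StepAlphaV3AC k`: `chart` (G3D-01 at the (25)-rate `C25·g_k·e^{−κ𝓛}`), `bound28` ((28): `‖B_X‖ ≤ cB·r(g_k)g_kp(g_k)`), `far_le` (G3D-06) and the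
G3D-08 binder `𝔄.N45` for the g-free (61)-born charts `Λ`; the jet is second order (`NewbornJet.abs_re_jet26_le`, Cauchy estimates) and the polylogarithms are
absorbed by one coupling factor (`NewbornJet.gcube_rsq_psq_le`, `g8_rp7_le`).  One WINDOW hypothesis: `cB·r(g_k)g_kp(g_k) ≤ ρ/4` (the configuration inside the
quarter-ball of G3D-01 — the `small28` of the lane's `Run3Newborn.abs_PY_le_series`; a γ-threshold, not an (α) row).

* `newConst 𝔠` — the constant; `newConst_nonneg`;
* **`abs_newTerm_le`** — `|newTerm p K k X W| ≤ newConst 𝔠 · (g_k p(g_k))² · e^{−κ·dj X}` for `k + 1 ≤ K`;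
* `abs_newTerm_le_theta` — the same with `(g_k p(g_k))² = θBal(K − k)²` (the interface's window letter, `PkgAtV3.eps1_eq`);
* `oldConst 𝔠`, **`abs_oldTerm_le`** — the OLD term of a block at level `i ≤ k`: `|oldTerm p K k i y W| ≤ 2C44(8L²B₃Z′)²·(g_kp(g_k))²·ℓ_i⁴`, `ℓ_i = L^{−(k−i)}`
  (print (44) ⟹ (45) per block: the lane's `h44`/`hfloor` rows + LQB `bound45_of_bound44` + `Bound46Series.bondSum45_le`, window `8L²B₃Z′·g_kp(g_k) ≤ ½`).
Bookkeeping over displayed rows and LQB/lane lemmas; nothing of [Balaban1985UV3] is asserted.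

References: T. Bałaban, CMP 102 (1985) 255–275 [Balaban1985UV3] ((25) p.262, (28)–(30) p.263, (33)–(34) p.264, (44)–(46) p.267, (61) p.271).
-/

set_option autoImplicit false

noncomputable section

namespace Summit.QuantumFields.YangMills.Theorems.GlobalSlackCanonicalPolymers

open scoped BigOperators
open Finset
open Literature.MathematicalPhysics.QuantumFieldTheory.Balaban1983to89
open Literature.MathematicalPhysics.QuantumFieldTheory.Balaban1983to89.T3ContinuumYM3Torus
open Literature.MathematicalPhysics.QuantumFieldTheory.Balaban1983to89.T3UnitScaleTilt (θBal)
open Literature.MathematicalPhysics.QuantumFieldTheory.Balaban1983to89.TreeLengthTorus (tsys)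
open Literature.MathematicalPhysics.QuantumFieldTheory.Balaban1985CMP102
open Literature.MathematicalPhysics.QuantumFieldTheory.Balaban1985CMP102.Setting
open Summit.QuantumFields.Balaban3D.Carriers
open Summit.QuantumFields.Balaban3D.Proofs.Primitives
open Summit.QuantumFields.Balaban3D.Proofs.Representation33 (jet26)
open Summit.QuantumFields.Balaban3D.Proofs.NewbornJet (tlConst tlConst_nonneg gcube_rsq_psq_le g8_rp7_le abs_re_jet26_le)
open Summit.QuantumFields.Balaban3D.Proofs.ScalesArithmetic (gk_pos gk_le_one)
open Summit.QuantumFields.Balaban3D.Proofs.Bound46Series (bondSum45_le)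
open Literature.MathematicalPhysics.QuantumFieldTheory.Balaban1983to89.B10SectCExpansion (Bound44 Bound45 blockSum45 bound45_of_bound44)
open Summit.QuantumFields.YangMills.Theorems

variable {F : T3Family} {𝔠 : AlphaConsts F.L (suGroupModel 2).N} {γ : ℝ} {hγ : 0 < γ} {hγ1 : γ ≤ (min 𝔠.gamma0 1) ^ 2}

/-- THE NEW-TERM CONSTANT: `20·C25·cB²/ρ²·tl(2r₀,1) + Cfar·C25·b₀⁵·tl(7r₀+5p₀,6) + C45·C63` (jet + far + (61)-born). [cite: Balaban1985UV3, (34) p.264, (44) p.267] -/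
def newConst (𝔠 : AlphaConsts F.L (suGroupModel 2).N) : ℝ :=
  20 * 𝔠.C25 * 𝔠.cB ^ 2 / 𝔠.ρ ^ 2 * tlConst (2 * 𝔠.r₀) 1 +
    𝔠.Cfar * 𝔠.C25 * 𝔠.b₀ ^ 5 * tlConst (7 * 𝔠.r₀ + 5 * 𝔠.p₀) 6 + 𝔠.C45 * 𝔠.C63

/-- The new-term constant is nonnegative. [folklore] -/
theorem newConst_nonneg (𝔠 : AlphaConsts F.L (suGroupModel 2).N) : 0 ≤ newConst 𝔠 := by
  have h1 := 𝔠.C25_nonneg; have h2 := 𝔠.cB_nonneg; have h3 := 𝔠.Cfar_nonneg; have h4 := 𝔠.C45_nonneg; have h5 := 𝔠.C63_nonneg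
  have h6 := 𝔠.b₀_pos.le; have hr := 𝔠.one_le_r₀; have hp := 𝔠.p₀_pos
  have t1 : 0 ≤ tlConst (2 * 𝔠.r₀) 1 := tlConst_nonneg (by linarith) one_pos
  have t2 : 0 ≤ tlConst (7 * 𝔠.r₀ + 5 * 𝔠.p₀) 6 := tlConst_nonneg (by linarith) (by norm_num)
  unfold newConst
  positivity

variable (p : ∀ K, AlphaInputsT3AC.PkgAtV3 F 𝔠 γ hγ hγ1 K)

/-- **THE SIZE OF A NEW TERM OF THE CANONICAL POLYMERISATION** ((44)/(34) at the birth level, both displayed chart families): for `k + 1 ≤ K` and the window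
`cB·r(g_k)g_kp(g_k) ≤ ρ/4`, `|newTerm p K k X W| ≤ newConst 𝔠 · (g_kp(g_k))² · e^{−κ·dj X}`. [cite: Balaban1985UV3, (25) p.262, (28) p.263, (34) p.264, (44)-(45) p.267] -/
theorem abs_newTerm_le (K k : ℕ) (hk : k + 1 ≤ K)
    (hsmall : 𝔠.cB * (B10.rFun 𝔠.r₀ ((SK F 𝔠 γ hγ hγ1 K).gk k) * (SK F 𝔠 γ hγ hγ1 K).gk k *
        B10.pFun 𝔠.b₀ 𝔠.p₀ ((SK F 𝔠 γ hγ hγ1 K).gk k)) ≤ 𝔠.ρ / 4)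
    (X : (tsys 3 (nblkOf (SK F 𝔠 γ hγ hγ1 K) 𝔠.lane.carrier k)).Dom) (W : GaugeField (F.P K) (k + 1) (Matrix.specialUnitaryGroup (Fin 2) ℂ)) :
    |newTerm p K k X W| ≤ newConst 𝔠 * ((SK F 𝔠 γ hγ hγ1 K).gk k * B10.pFun 𝔠.b₀ 𝔠.p₀ ((SK F 𝔠 γ hγ hγ1 K).gk k)) ^ 2 *
      Real.exp (-(𝔠.κ * (tsys 3 (nblkOf (SK F 𝔠 γ hγ hγ1 K) 𝔠.lane.carrier k)).dj X)) := by
  -- letters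
  set g : ℝ := (SK F 𝔠 γ hγ hγ1 K).gk k with hgdef
  set pg : ℝ := B10.pFun 𝔠.b₀ 𝔠.p₀ g with hpgdef
  set r : ℝ := B10.rFun 𝔠.r₀ g with hrdef
  set e : ℝ := Real.exp (-(𝔠.κ * (tsys 3 (nblkOf (SK F 𝔠 γ hγ hγ1 K) 𝔠.lane.carrier k)).dj X)) with hedef
  have hg0 : 0 < g := gk_pos _ k
  have hg1 : g ≤ 1 := gk_le_one _ (SK F 𝔠 γ hγ hγ1 K).gK_le_one k (by show k ≤ K; omega)
  have hpg0 : 0 ≤ pg := B10.pFun_nonneg _ _ _ 𝔠.b₀_pos.le hg0 hg1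
  have hr0 : 0 ≤ r := by rw [hrdef]; unfold B10.rFun; exact Real.rpow_nonneg (by linarith [B10.log_inv_nonneg_of_le_one hg0 hg1]) _
  have he0 : 0 ≤ e := (Real.exp_pos _).le
  have hρ : 0 < 𝔠.ρ := 𝔠.ρ_pos
  have hs0 : 0 ≤ 𝔠.cB * (r * g * pg) := mul_nonneg 𝔠.cB_nonneg (by positivity)
  -- the displayed rows
  have hstep := (p K).run.steps k hk
  obtain ⟨hρ', hdiff, hM⟩ := hstep.chart X
  have hB := hstep.bound28 X (Hist.triv (F.P K) (k + 1)) W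
  -- (a) the jet of the step chart is second order
  have hjet : |(jet26 (((p K).𝔖 k).Ψ X) (((p K).𝔖 k).Bcfg X (Hist.triv (F.P K) (k + 1)) W)).re| ≤
      5 * (𝔠.C25 * g * e) * (2 * (𝔠.cB * (r * g * pg)) / 𝔠.ρ) ^ 2 :=
    abs_re_jet26_le hρ' hdiff hM hs0 hsmall hB
  -- (b) the far terms
  have hfar : |((p K).𝔖 k).far X (Hist.triv (F.P K) (k + 1)) W| ≤ 𝔠.Cfar * ((𝔠.C25 * g * e) * (g ^ 7 * (r * pg) ^ 7)) :=
    hstep.far_le X (Hist.triv (F.P K) (k + 1)) W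
  -- (c) the (61)-born piece (G3D-08)
  have hΛ : |(jet26 (((p K).𝔄.Λc k).Ψ X) (((p K).𝔖 k).Bcfg X (Hist.triv (F.P K) (k + 1)) W)).re -
      ((p K).𝔄.Λc k).far X (Hist.triv (F.P K) (k + 1)) W| ≤ 𝔠.C45 * (g * pg) ^ 2 * (𝔠.C63 * e) :=
    ((p K).𝔄.N45 k).jet45 X (Hist.triv (F.P K) (k + 1)) W
  -- absorb the polylogarithms
  have hA : g ^ 3 * r ^ 2 * pg ^ 2 ≤ tlConst (2 * 𝔠.r₀) 1 * (g ^ 2 * pg ^ 2) :=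
    gcube_rsq_psq_le 𝔠.r₀ 𝔠.b₀ 𝔠.p₀ g (by linarith [𝔠.one_le_r₀]) hg0 hg1
  have hBfar : g ^ 8 * (r * pg) ^ 7 ≤ 𝔠.b₀ ^ 5 * tlConst (7 * 𝔠.r₀ + 5 * 𝔠.p₀) 6 * (g ^ 2 * pg ^ 2) :=
    g8_rp7_le 𝔠.r₀ 𝔠.b₀ 𝔠.p₀ g (by linarith [𝔠.one_le_r₀, 𝔠.p₀_pos]) 𝔠.b₀_pos.le hg0 hg1
  -- rewrite the three bounds in the common currency `(g pg)² e`
  have ha' : 5 * (𝔠.C25 * g * e) * (2 * (𝔠.cB * (r * g * pg)) / 𝔠.ρ) ^ 2 ≤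
      (20 * 𝔠.C25 * 𝔠.cB ^ 2 / 𝔠.ρ ^ 2 * tlConst (2 * 𝔠.r₀) 1) * ((g * pg) ^ 2 * e) := by
    have heq : 5 * (𝔠.C25 * g * e) * (2 * (𝔠.cB * (r * g * pg)) / 𝔠.ρ) ^ 2 =
        (20 * 𝔠.C25 * 𝔠.cB ^ 2 / 𝔠.ρ ^ 2) * e * (g ^ 3 * r ^ 2 * pg ^ 2) := by
      field_simp
      ring
    rw [heq]
    have hc : 0 ≤ (20 * 𝔠.C25 * 𝔠.cB ^ 2 / 𝔠.ρ ^ 2) * e := by have := 𝔠.C25_nonneg; have := 𝔠.cB_nonneg; positivity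
    calc (20 * 𝔠.C25 * 𝔠.cB ^ 2 / 𝔠.ρ ^ 2) * e * (g ^ 3 * r ^ 2 * pg ^ 2)
        ≤ (20 * 𝔠.C25 * 𝔠.cB ^ 2 / 𝔠.ρ ^ 2) * e * (tlConst (2 * 𝔠.r₀) 1 * (g ^ 2 * pg ^ 2)) := mul_le_mul_of_nonneg_left hA hc
      _ = _ := by ring
  have hb' : 𝔠.Cfar * ((𝔠.C25 * g * e) * (g ^ 7 * (r * pg) ^ 7)) ≤
      (𝔠.Cfar * 𝔠.C25 * 𝔠.b₀ ^ 5 * tlConst (7 * 𝔠.r₀ + 5 * 𝔠.p₀) 6) * ((g * pg) ^ 2 * e) := by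
    have heq : 𝔠.Cfar * ((𝔠.C25 * g * e) * (g ^ 7 * (r * pg) ^ 7)) = (𝔠.Cfar * 𝔠.C25 * e) * (g ^ 8 * (r * pg) ^ 7) := by ring
    rw [heq]
    have hc : 0 ≤ 𝔠.Cfar * 𝔠.C25 * e := by have := 𝔠.C25_nonneg; have := 𝔠.Cfar_nonneg; positivity
    calc (𝔠.Cfar * 𝔠.C25 * e) * (g ^ 8 * (r * pg) ^ 7)
        ≤ (𝔠.Cfar * 𝔠.C25 * e) * (𝔠.b₀ ^ 5 * tlConst (7 * 𝔠.r₀ + 5 * 𝔠.p₀) 6 * (g ^ 2 * pg ^ 2)) := mul_le_mul_of_nonneg_left hBfar hc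
      _ = _ := by ring
  have hc' : 𝔠.C45 * (g * pg) ^ 2 * (𝔠.C63 * e) = (𝔠.C45 * 𝔠.C63) * ((g * pg) ^ 2 * e) := by ring
  -- assemble
  have hsplit : newTerm p K k X W =
      ((jet26 (((p K).𝔖 k).Ψ X) (((p K).𝔖 k).Bcfg X (Hist.triv (F.P K) (k + 1)) W)).re -
        ((p K).𝔖 k).far X (Hist.triv (F.P K) (k + 1)) W) +
      ((jet26 (((p K).𝔄.Λc k).Ψ X) (((p K).𝔖 k).Bcfg X (Hist.triv (F.P K) (k + 1)) W)).re -
        ((p K).𝔄.Λc k).far X (Hist.triv (F.P K) (k + 1)) W) := rfl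
  rw [hsplit]
  calc |_ + _| ≤ |(jet26 (((p K).𝔖 k).Ψ X) (((p K).𝔖 k).Bcfg X (Hist.triv (F.P K) (k + 1)) W)).re -
          ((p K).𝔖 k).far X (Hist.triv (F.P K) (k + 1)) W| + _ := abs_add_le _ _
    _ ≤ (|(jet26 (((p K).𝔖 k).Ψ X) (((p K).𝔖 k).Bcfg X (Hist.triv (F.P K) (k + 1)) W)).re| +
          |((p K).𝔖 k).far X (Hist.triv (F.P K) (k + 1)) W|) + 𝔠.C45 * (g * pg) ^ 2 * (𝔠.C63 * e) :=
        add_le_add (abs_sub _ _) hΛ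
    _ ≤ ((20 * 𝔠.C25 * 𝔠.cB ^ 2 / 𝔠.ρ ^ 2 * tlConst (2 * 𝔠.r₀) 1) * ((g * pg) ^ 2 * e) +
          (𝔠.Cfar * 𝔠.C25 * 𝔠.b₀ ^ 5 * tlConst (7 * 𝔠.r₀ + 5 * 𝔠.p₀) 6) * ((g * pg) ^ 2 * e)) +
          (𝔠.C45 * 𝔠.C63) * ((g * pg) ^ 2 * e) := by
        rw [← hc']
        exact add_le_add (add_le_add (hjet.trans ha') (hfar.trans hb')) le_rfl
    _ = newConst 𝔠 * (g * pg) ^ 2 * e := by unfold newConst; ring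

/-- **THE SAME IN THE INTERFACE'S WINDOW LETTER**: `(g_kp(g_k))² = θBal F.L γ b₀ p₀ (K − k)²` (`PkgAtV3.eps1_eq`), so for `k + 1 ≤ K`,
`|newTerm p K k X W| ≤ newConst 𝔠 · θ(K − k)² · e^{−κ·dj X}`. [cite: Balaban1985UV3, (7) p.257, (44) p.267] -/
theorem abs_newTerm_le_theta (K k : ℕ) (hk : k + 1 ≤ K)
    (hsmall : 𝔠.cB * (B10.rFun 𝔠.r₀ ((SK F 𝔠 γ hγ hγ1 K).gk k) * (SK F 𝔠 γ hγ hγ1 K).gk k *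
        B10.pFun 𝔠.b₀ 𝔠.p₀ ((SK F 𝔠 γ hγ hγ1 K).gk k)) ≤ 𝔠.ρ / 4)
    (X : (tsys 3 (nblkOf (SK F 𝔠 γ hγ hγ1 K) 𝔠.lane.carrier k)).Dom) (W : GaugeField (F.P K) (k + 1) (Matrix.specialUnitaryGroup (Fin 2) ℂ)) :
    |newTerm p K k X W| ≤ newConst 𝔠 * θBal F.L γ 𝔠.b₀ 𝔠.p₀ (K - k) ^ 2 *
      Real.exp (-(𝔠.κ * (tsys 3 (nblkOf (SK F 𝔠 γ hγ hγ1 K) 𝔠.lane.carrier k)).dj X)) := by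
  have heps : (SK F 𝔠 γ hγ hγ1 K).gk k * B10.pFun 𝔠.b₀ 𝔠.p₀ ((SK F 𝔠 γ hγ hγ1 K).gk k) = θBal F.L γ 𝔠.b₀ 𝔠.p₀ (K - k) :=
    (p K).eps1_eq k (by omega)
  rw [← heps]
  exact abs_newTerm_le p K k hk hsmall X W

/-- THE OLD-TERM CONSTANT PER BLOCK: `2·C44·(8L²B₃Z′(κ₁/M₁))²` (the O(1)(O(M₁³))² of (45)). [cite: Balaban1985UV3, (45) p.267] -/
def oldConst (𝔠 : AlphaConsts F.L (suGroupModel 2).N) : ℝ := 2 * 𝔠.C44 * (8 * (F.L : ℝ) ^ 2 * 𝔠.B₃ * 𝔠.Zfull) ^ 2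

/-- The old-term constant is nonnegative. [folklore] -/
theorem oldConst_nonneg (𝔠 : AlphaConsts F.L (suGroupModel 2).N) : 0 ≤ oldConst 𝔠 := by
  have := 𝔠.C44_nonneg; unfold oldConst; positivity

/-- **THE SIZE OF AN OLD TERM OF THE CANONICAL POLYMERISATION, PER BLOCK** ((44) ⟹ (45) p.267 «summation over all Y_j with y fixed yields …
≤ O(1)(O(M₁³)g p(g))²(Lʲη)⁴»): for `k + 1 ≤ K`, `i ∈ [1, k]`, the window `8L²B₃Z′·g_kp(g_k) ≤ ½` and any level-`i` block `y`,
`|oldTerm p K k i y W| ≤ oldConst 𝔠 · (g_kp(g_k))² · ℓ_i⁴`, `ℓ_i = L^{−(k−i)}` — from the displayed rows `h44` ((44)) and `hfloor` (degree ≥ 2) through LQB's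
`bound45_of_bound44` and the torus bond sum `bondSum45_le` (nothing is dropped at the trivial history). [cite: Balaban1985UV3, (44)-(45) p.267] -/
theorem abs_oldTerm_le (K k : ℕ) (hk : k + 1 ≤ K) (i : ℕ) (hi : i ∈ Finset.Icc 1 k)
    (hsmall : 8 * (F.L : ℝ) ^ 2 * 𝔠.B₃ * 𝔠.Zfull * ((SK F 𝔠 γ hγ hγ1 K).gk k * B10.pFun 𝔠.b₀ 𝔠.p₀ ((SK F 𝔠 γ hγ hγ1 K).gk k)) ≤ 1 / 2)
    (y : Site (F.P K) i) (W : GaugeField (F.P K) (k + 1) (Matrix.specialUnitaryGroup (Fin 2) ℂ)) :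
    |oldTerm p K k i y W| ≤ oldConst 𝔠 * ((SK F 𝔠 γ hγ hγ1 K).gk k * B10.pFun 𝔠.b₀ 𝔠.p₀ ((SK F 𝔠 γ hγ hγ1 K).gk k)) ^ 2 *
      ell (F.P K) k i ^ 4 := by
  classical
  set g : ℝ := (SK F 𝔠 γ hγ hγ1 K).gk k with hgdef
  set pg : ℝ := B10.pFun 𝔠.b₀ 𝔠.p₀ g with hpgdef
  have hg0 : 0 < g := gk_pos _ k
  have hg1 : g ≤ 1 := gk_le_one _ (SK F 𝔠 γ hγ hγ1 K).gK_le_one k (by show k ≤ K; omega)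
  have hpg0 : 0 ≤ pg := B10.pFun_nonneg _ _ _ 𝔠.b₀_pos.le hg0 hg1
  have hM : 0 < 𝔠.M₁ := 𝔠.M₁_pos
  have hstep := (p K).run.steps k hk
  -- the value model at the trivial history: nothing is dropped
  let PU : (j : ℕ) → Site (F.P K) j → (n : ℕ) → (Fin n → PBond (F.P K) j) → ℝ :=
    fun j y n c => ((p K).𝔖 k).oldVal (Hist.triv (F.P K) (k + 1)) W j y n c
  have hterm : oldTerm p K k i y W = ∑ n ∈ range (((p K).𝔖 k).Ndeg i + 1),
      ∑ c ∈ Fintype.piFinset (fun _ : Fin n => oldBonds 𝔠.lane.carrier.M₁ (rcolOf (SK F 𝔠 γ hγ hγ1 K) 𝔠.lane.carrier) (Hist.triv (F.P K) (k + 1)) i y),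
        PU i y n c := by
    unfold oldTerm
    refine Finset.sum_congr rfl fun n _ => Finset.sum_congr rfl fun c _ => ?_
    rw [if_neg (not_drop_triv 𝔠.lane.carrier.M₁ (rcolOf (SK F 𝔠 γ hγ hγ1 K) 𝔠.lane.carrier) i y n c)]
  -- (45) per block from (44), degree floor and the torus bond sum
  have h45 : Bound45 (oldGeom (F.P K) k i)
      (blockSum45 (oldGeom (F.P K) k i) (PU i)
        (fun y => oldBonds 𝔠.lane.carrier.M₁ (rcolOf (SK F 𝔠 γ hγ hγ1 K) 𝔠.lane.carrier) (Hist.triv (F.P K) (k + 1)) i y) (((p K).𝔖 k).Ndeg i))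
      (8 * (F.L : ℝ) ^ 2 * 𝔠.B₃ * 𝔠.Zfull) g pg (ell (F.P K) k i) (2 * 𝔠.C44) := by
    refine bound45_of_bound44 (oldGeom (F.P K) k i) (PU i) _ _ (κ₁ := 𝔠.κ₁) (M₁ := (𝔠.M₁ : ℝ)) 𝔠.C44_nonneg (ell_pos (F.P K) k i)
      𝔠.B₃_pos.le hg0.le hpg0 (oldGeom_dist_nonneg (F.P K) k i) (hstep.h44 (Hist.triv (F.P K) (k + 1)) W i hi)
      (hstep.hfloor (Hist.triv (F.P K) (k + 1)) W i hi) (fun y₀ => bondSum45_le (S := SK F 𝔠 γ hγ hγ1 K) hM 𝔠.κ₁_pos k i _ y₀) ?_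
    have hℓ1 : ell (F.P K) k i ^ 2 ≤ 1 := by
      have hle : ell (F.P K) k i ≤ 1 := by
        unfold ell
        exact pow_le_one₀ (inv_nonneg.mpr (by exact_mod_cast (F.P K).L_pos.le))
          (inv_le_one_of_one_le₀ (by exact_mod_cast F.hL.2.le))
      exact pow_le_one₀ (ell_pos (F.P K) k i).le hle
    have h0 : 0 ≤ 8 * (F.L : ℝ) ^ 2 * 𝔠.B₃ * 𝔠.Zfull * g * pg := by
      have := 𝔠.B₃_pos; have := 𝔠.Zfull_pos; positivity
    calc 8 * (F.L : ℝ) ^ 2 * 𝔠.B₃ * 𝔠.Zfull * g * pg * ell (F.P K) k i ^ 2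
        ≤ 8 * (F.L : ℝ) ^ 2 * 𝔠.B₃ * 𝔠.Zfull * g * pg * 1 := mul_le_mul_of_nonneg_left hℓ1 h0
      _ ≤ 1 / 2 := by rw [mul_one]; simpa only [mul_assoc] using hsmall
  -- the signed sum is dominated by the block sum of absolute values
  have htri : |oldTerm p K k i y W| ≤ blockSum45 (oldGeom (F.P K) k i) (PU i)
      (fun y => oldBonds 𝔠.lane.carrier.M₁ (rcolOf (SK F 𝔠 γ hγ hγ1 K) 𝔠.lane.carrier) (Hist.triv (F.P K) (k + 1)) i y) (((p K).𝔖 k).Ndeg i) y := by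
    rw [hterm]
    unfold blockSum45
    refine (Finset.abs_sum_le_sum_abs _ _).trans (Finset.sum_le_sum fun n _ => ?_)
    exact Finset.abs_sum_le_sum_abs _ _
  refine htri.trans ((h45 y).trans (le_of_eq ?_))
  unfold oldConst
  ring

end Summit.QuantumFields.YangMills.Theorems.GlobalSlackCanonicalPolymers

end
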